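import Mathlib
import HarnessLib

/-!
# Route `DiophantineDichotomy`, crux `KhovanskiiApproxTypeEv` (stmt-Schanuel-14972), line `lambert-liouville-kill`:
# stub `stub_expRationalDist` — sup-norm distance of the exp-rational challenger `(1, p/q, α, w)`

Crux `Summit.Schanuel.Schanuel.Theses.DiophantineDichotomy.KhovanskiiApproxTypeEv` (item stmt-Schanuel-14972),
certificate line `lambert-liouville-kill` (skeleton `Cruxes/KhovanskiiApproxTypeEv/Lines/lambert_liouville_kill.lean`,
lead `prover-line-stmt-Schanuel-14972-a1-0`), registered stub `stub_expRationalDist` (landed `--supports stmt-Schanuel-14972`).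

STUB F4b of the general exp-rational certificate `notLiouville_expRational_of_ev` (extension of
`notLiouville_lambert_of_ev`): at the free Khovanskii point `θ = (1, x, e, eˣ)` the challenger
`γ = (1, p/q, α, w)`, whose fourth slot `w` satisfies `|w − eˣ| ≤ K |x − p/q|` with `K ≥ 1`, has sup (pi) norm
distance `‖γ − θ‖ ≤ max (‖e − α‖) (K |x − p/q|)` on `Fin 2 ⊕ Fin 2 → ℂ`.  Coordinatewise: `|1 − 1| = 0`,
`|p/q − x| ≤ K |x − p/q|` (factor `≥ 1`), `‖α − e‖ = ‖e − α‖`, and `‖(w : ℂ) − exp x‖ = |w − eˣ|`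
(hypothesis).  Mathlib only (`pi_norm_le_iff_of_nonneg`, real slots pushed to `ℝ` via
`Complex.ofReal_exp` / `Complex.norm_real`). [folklore]
-/

noncomputable section

-- `Summit.Schanuel.Schanuel.…` is the mandated summit/sub-problem namespace (single-conjunct summit), hence:
set_option linter.dupNamespace false

namespace Summit.Schanuel.Schanuel.Cruxes.KhovanskiiApproxTypeEv.LambertLiouvilleKill

open Polynomial

/-- The trivial slot with an abstract factor: `|r − x| ≤ K |x − r|` for `1 ≤ K`. -/
theorem abs_sub_le_mul_abs_sub_of_one_le (K x r : ℝ) (hK : 1 ≤ K) :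
    |r - x| ≤ K * |x - r| := by
  rw [abs_sub_comm]
  have h1 : 0 ≤ |x - r| := abs_nonneg _
  nlinarith

/-- **STUB F4b (distance of the exp-rational challenger).**  For `p : ℤ`, `q : ℕ`, reals `x w K`
with `1 ≤ K` and `|w − eˣ| ≤ K |x − p/q|`, and any `α : ℂ`, in the sup norm on `Fin 2 ⊕ Fin 2 → ℂ`:
`‖(1, p/q, α, w) − (1, x, e, eˣ)‖ ≤ max (‖e − α‖) (K |x − p/q|)`.
Proof: `pi_norm_le_iff_of_nonneg`, then the four coordinates separately; the two real ones are
pushed to `ℝ` via `push_cast` (`Complex.ofReal_intCast`, `Complex.ofReal_exp`) and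
`Complex.norm_real`. [folklore] -/
theorem stub_expRationalDist :
    ∀ (p : ℤ) (q : ℕ) (x w K : ℝ) (α : ℂ), 1 ≤ K → |w - Real.exp x| ≤ K * |x - (p : ℝ) / q| →
      ‖Sum.elim ![(1 : ℂ), (p : ℂ) / q] ![α, (w : ℂ)] -
          Sum.elim ![(1 : ℂ), (x : ℂ)] (Complex.exp ∘ ![(1 : ℂ), (x : ℂ)])‖ ≤
        max ‖Complex.exp 1 - α‖ (K * |x - (p : ℝ) / q|) := by
  intro p q x w K α hK hw
  have hR : 0 ≤ max ‖Complex.exp 1 - α‖ (K * |x - (p : ℝ) / q|) :=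
    (norm_nonneg _).trans (le_max_left _ _)
  refine (pi_norm_le_iff_of_nonneg hR).mpr ?_
  rintro (i | i) <;> fin_cases i
  · -- slot `inl 0`: `1 − 1 = 0`
    simp
  · -- slot `inl 1`: `p/q − x`
    refine le_max_of_le_right ?_
    have hcast : ((p : ℂ) / q - (x : ℂ)) = (((p : ℝ) / q - x : ℝ) : ℂ) := by push_cast; rfl
    simp only [Fin.mk_one, Pi.sub_apply, Sum.elim_inl, Matrix.cons_val_one, Matrix.cons_val_fin_one]
    rw [hcast, Complex.norm_real, Real.norm_eq_abs]
    exact abs_sub_le_mul_abs_sub_of_one_le K x _ hK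
  · -- slot `inr 0`: `α − e`
    refine le_max_of_le_left ?_
    simp [norm_sub_rev]
  · -- slot `inr 1`: `w − eˣ`
    refine le_max_of_le_right ?_
    have hcast : ((w : ℂ) - Complex.exp (x : ℂ)) = ((w - Real.exp x : ℝ) : ℂ) := by
      push_cast
      rfl
    simp only [Fin.mk_one, Pi.sub_apply, Sum.elim_inr, Matrix.cons_val_one, Matrix.cons_val_fin_one,
      Function.comp_apply]
    rw [hcast, Complex.norm_real, Real.norm_eq_abs]
    exact hw

end Summit.Schanuel.Schanuel.Cruxes.KhovanskiiApproxTypeEv.LambertLiouvilleKill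

end
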